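import Literature.Computability.Cryptography.LWENoise
import Mathlib.Analysis.SpecialFunctions.Complex.CircleAddChar
import Mathlib.Analysis.Fourier.AddCircle
import Mathlib.NumberTheory.LegendreSymbol.AddCharacter
import Mathlib.MeasureTheory.Measure.CharacteristicFunction.Basic
import Mathlib.Probability.ProbabilityMassFunction.Integrals
import HarnessLib

/-!
# Regev 2009, Lemma 3.6 (verifying solutions of `LWE`): the mean of the test statistic

Topic `Computability/Cryptography` (family `pqc`), grouping namespace `Regev2009`. Everything here is
PROVED (theorems, plus three small definitions WITH BODIES naming the printed objects; no named fact).

**Lemma 3.6** (Regev, J. ACM 56 (2009) = arXiv:2401.03703, §3.2.1): *given `s'` and samples from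
`A_{s,Ψ_α}` (unknown `s`, `α < 1`), decide whether `s = s'`.* The printed test: from each sample
`(a, x)` form `y = x - ⟨a, s'⟩/p ∈ 𝕋`, compute `z = (1/n) ∑ cos(2πyᵢ)`, accept iff `z > 0.02`. Its
analysis rests on the MEAN of the statistic: `z̃ = E[cos(2πy)]` equals `e^{-πα²}` (`≥ 0.04` for
`α < 1`) when `s = s'`, and `0` when `s ≠ s'` ("`ξ` has a period of `1/k` for some `k ≥ 2` …
`∫ e^{2πiy}ξ(y)dy = e^{2πi/k} ∫ e^{2πiy}ξ(y)dy`, which implies … `z̃ = 0`"); a Chernoff bound then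
separates the two cases. This file proves exactly those two means, for the tree's torus `LWE`
distribution `LWE.torusLWESample q φ s` (`LWENoise.lean`) — the remaining step (concentration of the
empirical mean of `n` bounded samples) is the tree's Hoeffding/Chernoff machinery
(`Probability/Moments/HoeffdingCounting.lean`, Mathlib `HasSubgaussianMGF.measure_sum_ge_le_of_iIndepFun`)
and belongs with the machine that runs the test. It serves Lemma 3.7/3.4 (= Peikert's Prop. 3.2,
hypothesis `h₂` of `peikert_gapSVPZeta_to_lwe_classical_of_components`, pqc.S20; also Regev's Thm. 3.1,
pqc.S19).

## Results

* `cosTwoPi y` (`= cos(2πx)` on `y = ↑x`, `cosTwoPi_coe`), `testChar q s' (a, b) = e^{2πi(b - ⟨a,s'⟩/q)}`,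
  `dotChar d` — the additive character `a ↦ e^{2πi⟨a,d⟩/q}` of `ℤ_qⁿ` (`dotChar_ne_one` for `d ≠ 0`).
* `integral_toCircle_wrappedGaussian`, `integral_cosTwoPi_wrappedGaussian` — **`E_{Ψ_β}[e^{2πiy}] =
  E_{Ψ_β}[cos 2πy] = e^{-πβ²}`** (Mathlib's `charFun_gaussianReal` at `2π`; `Ψ_β = N(0, β²/(2π)) mod 1`);
  `exp_neg_pi_le_exp_neg_pi_mul_sq` (`≥ e^{-π}` for `|β| ≤ 1`).
* `sum_toCircle_dotProduct_eq_zero` — **the cancellation**: `∑_{a ∈ ℤ_qⁿ} e^{2πi⟨a,d⟩/q} = 0` for `d ≠ 0`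
  (a nontrivial character sums to zero, Mathlib `AddChar.sum_eq_zero_of_ne_one`).
* `integral_testChar_torusLWESample` — for ANY noise law `φ`:
  `E_{A_{s,φ}}[e^{2πi(b - ⟨a,s'⟩/q)}] = (q⁻ⁿ ∑_a e^{2πi⟨a, s-s'⟩/q}) · ∫ e^{2πiy} dφ` (the sample map
  factors the character, `testChar_torusSampleMap`; Fubini `integral_prod_mul`); hence
  `integral_testChar_torusLWESample_of_ne` (`= 0` for `s' ≠ s`), `…_self` (`= e^{-πβ²}` for `φ = Ψ_β`),
  and the real form `integral_cosTwoPi_torusLWESample`: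
  `E_{A_{s,Ψ_β}}[cos(2π(b - ⟨a,s'⟩/q))] = if s' = s then e^{-πβ²} else 0`.

## Faithfulness notes

* Regev argues via the period `1/k` of the law of `y`; the character-sum form used here is the same
  computation (his footnote: "this expectation is essentially the Fourier series of `ξ` at point `1`").
* The statement is for the torus samples `A_{s,Ψ_β}` of `LWENoise.lean` (Regev's own objects). A
  reduction holding exact rationals `⟨x,v⟩/p` and its own noise samples evaluates the same statistic;
  for samples already discretised to `ℤ_p` the character `e^{2πi b̄/p}` has the same cancellation for
  `s' ≠ s` (the `a`-sum is unchanged), while the `s' = s` mean becomes that of the discretised noise.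

## References

* O. Regev, *On lattices, learning with errors, random linear codes, and cryptography*, J. ACM 56
  (2009), art. 34 = arXiv:2401.03703, Lemma 3.6 and its proof (§3.2.1) [RegevLWE2009] (held; chunk
  p0016).
-/

noncomputable section

open MeasureTheory ProbabilityTheory Complex
open scoped Real ENNReal NNReal

namespace Literature.Computability.Cryptography

namespace Regev2009

/-! ### `cos(2πy)` on the torus and its mean under `Ψ_β` -/

/-- LOCAL GLUE. The test function `y ↦ cos(2πy)` on the torus `𝕋 = ℝ/ℤ` (Regev 2009, proof of
Lemma 3.6: "`z := (1/n) ∑ cos(2πyᵢ)`"), as the real part of the standard character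
`y ↦ e^{2πiy}` (`AddCircle.toCircle`). [cite: RegevLWE2009, Lemma 3.6 (proof)] -/
def cosTwoPi (y : UnitAddCircle) : ℝ := ((AddCircle.toCircle y : Circle) : ℂ).re

/-- `cosTwoPi ↑x = cos(2πx)`. [folklore] -/
theorem cosTwoPi_coe (x : ℝ) : cosTwoPi (x : UnitAddCircle) = Real.cos (2 * π * x) := by
  rw [cosTwoPi, AddCircle.toCircle_apply_mk, Circle.coe_exp, div_one, Complex.exp_ofReal_mul_I_re]

/-- The character `y ↦ e^{2πiy}` as a complex-valued function on the torus is continuous, hence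
measurable, and bounded by `1`. [folklore] -/
theorem continuous_toCircle_coe : Continuous fun y : UnitAddCircle => ((AddCircle.toCircle y : Circle) : ℂ) :=
  continuous_subtype_val.comp AddCircle.continuous_toCircle

/-- **"A routine calculation shows that for `ξ = Ψ_α`, `z̃ = e^{-πα²}`"** (Regev 2009, proof of
Lemma 3.6), complex form: `∫ e^{2πiy} dΨ_β(y) = e^{-πβ²}` — the characteristic function of
`N(0, β²/(2π))` at `2π` (Mathlib's `charFun_gaussianReal`). [cite: RegevLWE2009, Lemma 3.6 (proof)] -/
theorem integral_toCircle_wrappedGaussian (β : ℝ) :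
    ∫ y, ((AddCircle.toCircle y : Circle) : ℂ) ∂(LWE.wrappedGaussian β) = (Real.exp (-(π * β ^ 2)) : ℂ) := by
  rw [LWE.wrappedGaussian, integral_map LWE.measurable_coe_unitAddCircle.aemeasurable
    continuous_toCircle_coe.aestronglyMeasurable]
  have hfun : (fun x : ℝ => ((AddCircle.toCircle (x : UnitAddCircle) : Circle) : ℂ)) =
      fun x : ℝ => cexp ((2 * π : ℝ) * x * I) := by
    funext x
    rw [AddCircle.toCircle_apply_mk, Circle.coe_exp, div_one]
    push_cast
    ring_nf
  rw [hfun, ← charFun_apply_real, charFun_gaussianReal]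
  push_cast
  rw [Real.coe_toNNReal _ (by positivity)]
  push_cast
  field_simp
  ring

/-- **`E_{Ψ_β}[cos(2πy)] = e^{-πβ²}`** (Regev 2009, proof of Lemma 3.6: "which is at least `0.04`
for `α < 1`"). [cite: RegevLWE2009, Lemma 3.6 (proof)] -/
theorem integral_cosTwoPi_wrappedGaussian (β : ℝ) :
    ∫ y, cosTwoPi y ∂(LWE.wrappedGaussian β) = Real.exp (-(π * β ^ 2)) := by
  have hint : Integrable (fun y : UnitAddCircle => ((AddCircle.toCircle y : Circle) : ℂ))
      (LWE.wrappedGaussian β) :=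
    Integrable.of_bound continuous_toCircle_coe.aestronglyMeasurable 1
      (Filter.Eventually.of_forall fun y => by simp)
  have h := congrArg Complex.re (integral_toCircle_wrappedGaussian β)
  have h2 := integral_re hint
  simp only [RCLike.re_to_complex] at h2
  rw [← h2, Complex.ofReal_re] at h
  exact h

/-- The lower bound used by the test: `e^{-πβ²} ≥ e^{-π}` for `|β| ≤ 1` (Regev: "at least `0.04` for
`α < 1`"; `e^{-π} ≈ 0.0432`). [cite: RegevLWE2009, Lemma 3.6 (proof)] -/
theorem exp_neg_pi_le_exp_neg_pi_mul_sq {β : ℝ} (hβ : |β| ≤ 1) :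
    Real.exp (-π) ≤ Real.exp (-(π * β ^ 2)) := by
  have hβ2 : β ^ 2 ≤ 1 := by
    have h := pow_le_one₀ (abs_nonneg β) hβ (n := 2)
    rwa [sq_abs] at h
  exact Real.exp_le_exp.2 (by nlinarith [Real.pi_pos])

/-! ### The character sum over `a`: a wrong guess kills the Fourier coefficient -/

section CharSum

variable {ι : Type} [Fintype ι] [DecidableEq ι] {q : ℕ} [NeZero q]

/-- The additive character `a ↦ e^{2πi⟨a, d⟩/q}` of `ℤ_qⁿ` (complex-valued). [folklore] -/
def dotChar (d : ι → ZMod q) : AddChar (ι → ZMod q) ℂ :=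
  (ZMod.stdAddChar (N := q)).compAddMonoidHom
    (AddMonoidHom.mk' (fun a : ι → ZMod q => a ⬝ᵥ d) fun a b => add_dotProduct a b d)

omit [DecidableEq ι] in
/-- Unfolding. [folklore] -/
theorem dotChar_apply (d a : ι → ZMod q) :
    dotChar d a = ((ZMod.toCircle (a ⬝ᵥ d) : Circle) : ℂ) := rfl

/-- For `d ≠ 0` the character `a ↦ e^{2πi⟨a, d⟩/q}` is nontrivial (test it on `eⱼ` with `dⱼ ≠ 0`).
[folklore] -/
theorem dotChar_ne_one {d : ι → ZMod q} (hd : d ≠ 0) : dotChar d ≠ 1 := by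
  obtain ⟨j, hj⟩ : ∃ j, d j ≠ 0 := by
    by_contra h
    push Not at h
    exact hd (funext h)
  rw [AddChar.ne_one_iff]
  refine ⟨Pi.single j 1, ?_⟩
  rw [dotChar, AddChar.compAddMonoidHom_apply, AddMonoidHom.mk'_apply, single_dotProduct, one_mul]
  intro h
  apply hj
  have h0 : (ZMod.stdAddChar (N := q)) (d j) = (ZMod.stdAddChar (N := q)) 0 := by
    rw [h, AddChar.map_zero_eq_one]
  exact ZMod.injective_stdAddChar h0

/-- **Regev 2009, proof of Lemma 3.6 (the cancellation):** "if `s ≠ s'` … the distribution of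
`aⱼ(sⱼ - s'ⱼ)/p mod 1` is periodic with period `1/k` for some `k ≥ 2` … which implies that
`z̃ = 0`". In character form: for `d = s - s' ≠ 0`, `∑_{a ∈ ℤ_qⁿ} e^{2πi⟨a, d⟩/q} = 0`.
[cite: RegevLWE2009, Lemma 3.6 (proof)] -/
theorem sum_toCircle_dotProduct_eq_zero {d : ι → ZMod q} (hd : d ≠ 0) :
    ∑ a : ι → ZMod q, ((ZMod.toCircle (a ⬝ᵥ d) : Circle) : ℂ) = 0 := by
  have h := AddChar.sum_eq_zero_of_ne_one (dotChar_ne_one hd)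
  simpa only [dotChar_apply] using h

end CharSum

/-! ### The mean of the test statistic under `A_{s,φ}` -/

section Mean

variable {ι : Type} [Fintype ι] [DecidableEq ι] (q : ℕ) [NeZero q]

/-- Regev's statistic on a sample `(a, b) ∈ ℤ_qⁿ × 𝕋` for the candidate `s'`: the character value
`e^{2πi(b - ⟨a, s'⟩/q)}` (its real part is `cos(2π(b - ⟨a, s'⟩/q))`, `cosTwoPi`). [cite: RegevLWE2009, Lemma 3.6 (proof)] -/
def testChar (s' : ι → ZMod q) (x : (ι → ZMod q) × UnitAddCircle) : ℂ :=
  ((AddCircle.toCircle (x.2 - ZMod.toAddCircle (x.1 ⬝ᵥ s')) : Circle) : ℂ)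

omit [DecidableEq ι] in
/-- On a sample produced by `torusSampleMap q s` from `(a, e)` the statistic factors:
`e^{2πi(⟨a,s⟩/q + e - ⟨a,s'⟩/q)} = e^{2πi⟨a, s - s'⟩/q} · e^{2πie}`. [cite: RegevLWE2009, Lemma 3.6 (proof)] -/
theorem testChar_torusSampleMap (s s' : ι → ZMod q) (a : ι → ZMod q) (e : UnitAddCircle) :
    testChar q s' (LWE.torusSampleMap q s (a, e)) =
      ((ZMod.toCircle (a ⬝ᵥ (s - s')) : Circle) : ℂ) * ((AddCircle.toCircle e : Circle) : ℂ) := by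
  rw [testChar, LWE.torusSampleMap]
  simp only
  rw [← ZMod.toAddCircle_apply, show ZMod.toAddCircle (a ⬝ᵥ s) + e - ZMod.toAddCircle (a ⬝ᵥ s') =
      ZMod.toAddCircle (a ⬝ᵥ (s - s')) + e by rw [dotProduct_sub, map_sub]; abel,
    AddCircle.toCircle_add, Circle.coe_mul]
  rfl

omit [DecidableEq ι] in
/-- Measurability of the statistic. [folklore] -/
theorem measurable_testChar (s' : ι → ZMod q) : Measurable (testChar q s') := by
  unfold testChar
  refine continuous_toCircle_coe.measurable.comp ?_
  exact measurable_from_prod_countable_right fun a =>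
    (measurable_sub_const _ : Measurable fun y : UnitAddCircle => y - ZMod.toAddCircle (a ⬝ᵥ s'))

/-- **Regev 2009, Lemma 3.6, the mean of the test statistic.** For the torus `LWE` distribution
`A_{s,φ}` (`LWE.torusLWESample q φ s`, any noise law `φ`, a probability measure on `𝕋`) and a
candidate `s'`: `E[e^{2πi(b - ⟨a, s'⟩/q)}] = (q^{-n} ∑_a e^{2πi⟨a, s - s'⟩/q}) · ∫ e^{2πiy} dφ(y)`;
hence it VANISHES when `s' ≠ s` (`sum_toCircle_dotProduct_eq_zero`) and equals `∫ e^{2πiy} dφ`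
(`= e^{-πβ²}` for `φ = Ψ_β`, `integral_toCircle_wrappedGaussian`) when `s' = s`.
[cite: RegevLWE2009, Lemma 3.6 (proof)] -/
theorem integral_testChar_torusLWESample (φ : Measure UnitAddCircle) [IsProbabilityMeasure φ]
    (s s' : ι → ZMod q) :
    ∫ x, testChar q s' x ∂(LWE.torusLWESample q φ s) =
      ((Fintype.card (ι → ZMod q) : ℂ)⁻¹ * ∑ a : ι → ZMod q, ((ZMod.toCircle (a ⬝ᵥ (s - s')) : Circle) : ℂ)) *
        ∫ e, ((AddCircle.toCircle e : Circle) : ℂ) ∂φ := by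
  rw [LWE.torusLWESample, integral_map (LWE.measurable_torusSampleMap q s).aemeasurable
    (measurable_testChar q s').aestronglyMeasurable]
  have hfun : (fun x : (ι → ZMod q) × UnitAddCircle => testChar q s' (LWE.torusSampleMap q s x)) =
      fun x => ((ZMod.toCircle (x.1 ⬝ᵥ (s - s')) : Circle) : ℂ) * ((AddCircle.toCircle x.2 : Circle) : ℂ) := by
    funext x
    exact testChar_torusSampleMap q s s' x.1 x.2
  rw [hfun, integral_prod_mul (μ := (PMF.uniformOfFintype (ι → ZMod q)).toMeasure) (ν := φ)
    (fun a : ι → ZMod q => ((ZMod.toCircle (a ⬝ᵥ (s - s')) : Circle) : ℂ))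
    (fun e : UnitAddCircle => ((AddCircle.toCircle e : Circle) : ℂ))]
  congr 1
  rw [PMF.integral_eq_sum, Finset.mul_sum]
  refine Finset.sum_congr rfl fun a _ => ?_
  rw [PMF.uniformOfFintype_apply, ENNReal.toReal_inv, ENNReal.toReal_natCast, Complex.real_smul]
  push_cast
  ring

/-- **Wrong guess: the mean vanishes** (Regev: "if `k ≥ 2` then `z̃ = 0`"), for every noise law `φ`.
[cite: RegevLWE2009, Lemma 3.6 (proof)] -/
theorem integral_testChar_torusLWESample_of_ne (φ : Measure UnitAddCircle) [IsProbabilityMeasure φ]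
    {s s' : ι → ZMod q} (h : s' ≠ s) :
    ∫ x, testChar q s' x ∂(LWE.torusLWESample q φ s) = 0 := by
  rw [integral_testChar_torusLWESample, sum_toCircle_dotProduct_eq_zero (sub_ne_zero.2 (Ne.symm h)),
    mul_zero, zero_mul]

/-- **Right guess: the mean is `e^{-πβ²}`** (Regev: "if `s = s'`, `ξ` is exactly `Ψ_α` … `z̃ = e^{-πα²}`").
[cite: RegevLWE2009, Lemma 3.6 (proof)] -/
theorem integral_testChar_torusLWESample_self (β : ℝ) (s : ι → ZMod q) :
    ∫ x, testChar q s x ∂(LWE.torusLWESample q (LWE.wrappedGaussian β) s) = (Real.exp (-(π * β ^ 2)) : ℂ) := by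
  rw [integral_testChar_torusLWESample, sub_self, integral_toCircle_wrappedGaussian]
  have hcard : (Fintype.card (ι → ZMod q) : ℂ) ≠ 0 := Nat.cast_ne_zero.2 Fintype.card_ne_zero
  have h1 : ∀ a : ι → ZMod q, ((ZMod.toCircle (a ⬝ᵥ (0 : ι → ZMod q)) : Circle) : ℂ) = 1 := fun a => by
    rw [dotProduct_zero, AddChar.map_zero_eq_one, Circle.coe_one]
  simp_rw [h1]
  rw [Finset.sum_const, Finset.card_univ, nsmul_eq_mul, mul_one, inv_mul_cancel₀ hcard, one_mul]

/-- **The real statistic.** `E[cos(2π(b - ⟨a, s'⟩/q))]` is `e^{-πβ²}` for `s' = s` and `0` for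
`s' ≠ s` under `A_{s,Ψ_β}` — the two means that the empirical average `z` of Lemma 3.6 separates
(threshold `0.02`, Chernoff). [cite: RegevLWE2009, Lemma 3.6 (proof)] -/
theorem integral_cosTwoPi_torusLWESample (β : ℝ) (s s' : ι → ZMod q) :
    ∫ x, cosTwoPi (x.2 - ZMod.toAddCircle (x.1 ⬝ᵥ s')) ∂(LWE.torusLWESample q (LWE.wrappedGaussian β) s) =
      if s' = s then Real.exp (-(π * β ^ 2)) else 0 := by
  have hint : Integrable (testChar q s') (LWE.torusLWESample q (LWE.wrappedGaussian β) s) :=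
    Integrable.of_bound (measurable_testChar q s').aestronglyMeasurable 1
      (Filter.Eventually.of_forall fun x => by simp [testChar])
  have hre : (fun x : (ι → ZMod q) × UnitAddCircle => cosTwoPi (x.2 - ZMod.toAddCircle (x.1 ⬝ᵥ s'))) =
      fun x => (testChar q s' x).re := rfl
  have h2 := integral_re hint
  simp only [RCLike.re_to_complex] at h2
  rw [hre, h2]
  split_ifs with h
  · subst h
    rw [integral_testChar_torusLWESample_self, Complex.ofReal_re]
  · rw [integral_testChar_torusLWESample_of_ne q _ h, Complex.zero_re]

end Mean

end Regev2009

end Literature.Computability.Cryptography
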